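import Mathlib
import Summits.MatrixMultiplication.MatrixMultiplication.Theorems.GradedDesignFamily.Negative.SubfieldCellBoundedIndex
import Summits.MatrixMultiplication.MatrixMultiplication.Theorems.GradedDesignFamily.Negative.SubfieldCellNormalForm
import Summits.MatrixMultiplication.MatrixMultiplication.Theorems.GradedDesignFamily.Negative.SubfieldCellOvergroups

/-!
# Subfield cell — (NG): a dense piece of `φ(SL₂ k)` inside a subgroup `L ≤ SL₂(K)` of order
# `≥ c₁|K|²` forces `L = SL₂(K)` (route (D′); replaces the hypothesis (Dickson))

HONEST FRAMING.  Part of the NEGATIVE decision of the subfield-cell stub `S3` of the crux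
`LevelGradedCohnUmans.GradedDesignFamily` (stmt-MatrixMultiplication-7610).  The value is a THEOREM
on finite groups that lets the composition `structureDichotomy_of_pieces` run WITHOUT Dickson's
classification of subgroups of `SL₂(K)` — NOT summit progress.

## Statement (NG)

For real `M` and `c₁ > 0` there is `Q₅` such that: if `φ : SL₂(k) →* GL₂(K)` is injective,
`|K| = |k|² ≥ Q₅`, `L ≤ ker det` is a subgroup, `x ∈ GL₂(K)`, `P ⊆ SL₂(k)` has `|SL₂(k)| ≤ M|P|`
and `x⁻¹ φ(s s'⁻¹) x ∈ L` for all `s, s' ∈ P`, and `L` contains a finite set of `≥ c₁|K|²`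
elements, then `L = ker det`.

## Proof

`R = (x⁻¹φx)⁻¹(L) ⊇ P s₀⁻¹` has index `≤ ⌈M⌉` in `SL₂(k)`, hence `R = SL₂(k)`
(`subfieldCell_boundedIndex`); so `x⁻¹ φ x` maps into `L`, and by the normal form
(`subfieldCell_normalForm`) a conjugate `L'` of `L` contains the standard copy of `SL₂(k)`;
`subfieldCell_overgroup` gives `L' ⊇ ker det` (so `L = ker det`) or `|L| = |L'| ≤ 4|k|³ < c₁|k|⁴`.

Sorry-free. [folklore]
-/

set_option linter.dupNamespace false

open Matrix

namespace Summit.MatrixMultiplication.MatrixMultiplication.Theorems.GradedDesignFamily.Negative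

/-- **(NG).**  See the module docstring.  NOT summit progress. [folklore] -/
theorem subfieldCell_nonGeneration (M c₁ : ℝ) (hc₁ : 0 < c₁) :
    ∃ Q₅ : ℕ, ∀ (k K : Type) [Field k] [Fintype k] [DecidableEq k] [Field K] [Fintype K]
      [DecidableEq K]
      (φ : Matrix.SpecialLinearGroup (Fin 2) k →* Matrix.GeneralLinearGroup (Fin 2) K),
      Function.Injective φ → Fintype.card K = Fintype.card k ^ 2 → Q₅ ≤ Fintype.card K →
      ∀ L : Subgroup (Matrix.GeneralLinearGroup (Fin 2) K),
        L ≤ (Matrix.GeneralLinearGroup.det : Matrix.GeneralLinearGroup (Fin 2) K →* Kˣ).ker →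
        ∀ (x : Matrix.GeneralLinearGroup (Fin 2) K)
          (P : Finset (Matrix.SpecialLinearGroup (Fin 2) k)),
          (Fintype.card (Matrix.SpecialLinearGroup (Fin 2) k) : ℝ) ≤ M * P.card →
          (∀ s ∈ P, ∀ s' ∈ P, x⁻¹ * φ (s * s'⁻¹) * x ∈ L) →
          (∃ B : Finset (Matrix.GeneralLinearGroup (Fin 2) K),
            (↑B : Set (Matrix.GeneralLinearGroup (Fin 2) K)) ⊆ L ∧
              c₁ * (Fintype.card K : ℝ) ^ 2 ≤ B.card) →
          L = (Matrix.GeneralLinearGroup.det : Matrix.GeneralLinearGroup (Fin 2) K →* Kˣ).ker := by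
  obtain ⟨q₀, hq₀⟩ := subfieldCell_boundedIndex ⌈M⌉₊
  refine ⟨max (max (q₀ ^ 2) 25) ((⌊4 / c₁⌋₊ + 1) ^ 2), ?_⟩
  intro k K _ _ _ _ _ _ φ hφ hK hQ L hL x P hP hPL hB
  classical
  set q := Fintype.card k with hqdef
  have hq₀q : q₀ ≤ q := by
    have h : q₀ ^ 2 ≤ q ^ 2 := by
      rw [← hK]; exact ((le_max_left _ _).trans (le_max_left _ _)).trans hQ
    exact (Nat.pow_le_pow_iff_left two_ne_zero).1 h
  have hq5 : 5 ≤ q := by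
    have h : 5 ^ 2 ≤ q ^ 2 := by
      rw [← hK]; exact ((le_max_right _ _).trans (le_max_left _ _)).trans hQ
    exact (Nat.pow_le_pow_iff_left two_ne_zero).1 h
  have hqc : 4 < c₁ * q := by
    have h1 : (⌊4 / c₁⌋₊ + 1) ^ 2 ≤ q ^ 2 := by rw [← hK]; exact (le_max_right _ _).trans hQ
    have h2 : ⌊4 / c₁⌋₊ + 1 ≤ q := (Nat.pow_le_pow_iff_left two_ne_zero).1 h1
    have h3 : 4 / c₁ < q := (Nat.lt_floor_add_one _).trans_le (by exact_mod_cast h2)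
    rw [div_lt_iff₀ hc₁] at h3
    linarith
  -- ### the conjugated hom `ψ = x⁻¹ φ x`
  set ψ : Matrix.SpecialLinearGroup (Fin 2) k →* Matrix.GeneralLinearGroup (Fin 2) K :=
    (MulAut.conj x⁻¹).toMonoidHom.comp φ with hψdef
  have hψ : ∀ a, ψ a = x⁻¹ * φ a * x := fun a => by
    show (MulAut.conj x⁻¹) (φ a) = _
    rw [MulAut.conj_apply, inv_inv]
  have hψinj : Function.Injective ψ := (MulAut.conj x⁻¹).injective.comp hφ
  -- ### `R = ψ⁻¹(L)` has bounded index, hence `R = ⊤`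
  set R : Subgroup (Matrix.SpecialLinearGroup (Fin 2) k) := L.comap ψ with hRdef
  obtain ⟨s₀, hs₀⟩ : P.Nonempty := by
    rw [← Finset.card_pos]
    by_contra h0
    have hP0 : P.card = 0 := by omega
    have hpos : (0 : ℝ) < Fintype.card (Matrix.SpecialLinearGroup (Fin 2) k) := by
      exact_mod_cast Fintype.card_pos
    rw [hP0, Nat.cast_zero, mul_zero] at hP
    linarith
  have hPR : ∀ s ∈ P, s * s₀⁻¹ ∈ R := fun s hs => by
    rw [hRdef, Subgroup.mem_comap, hψ, map_mul, map_inv]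
    have := hPL s hs s₀ hs₀
    rwa [map_mul, map_inv] at this
  have hcardR : P.card ≤ Nat.card R := by
    have e : Nat.card R =
        (Finset.univ.filter fun s : Matrix.SpecialLinearGroup (Fin 2) k => s ∈ R).card :=
      Nat.subtype_card _ (fun s => by simp)
    rw [e, ← Finset.card_image_of_injective P (mul_left_injective s₀⁻¹)]
    apply Finset.card_le_card
    intro t ht
    obtain ⟨s, hs, rfl⟩ := Finset.mem_image.1 ht
    simpa using hPR s hs
  have hidx : Fintype.card (Matrix.SpecialLinearGroup (Fin 2) k) ≤ ⌈M⌉₊ * Nat.card R := by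
    have h1 : (Fintype.card (Matrix.SpecialLinearGroup (Fin 2) k) : ℝ) ≤
        (⌈M⌉₊ : ℝ) * (Nat.card R : ℝ) := by
      calc (Fintype.card (Matrix.SpecialLinearGroup (Fin 2) k) : ℝ) ≤ M * P.card := hP
        _ ≤ ⌈M⌉₊ * Nat.card R :=
            mul_le_mul (Nat.le_ceil M) (by exact_mod_cast hcardR) (Nat.cast_nonneg _)
              (Nat.cast_nonneg _)
    exact_mod_cast h1
  have hRtop : R = ⊤ := hq₀ k hq₀q R hidx
  have hψL : ∀ a, ψ a ∈ L := fun a => by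
    have h : a ∈ R := hRtop ▸ Subgroup.mem_top a
    rw [hRdef, Subgroup.mem_comap] at h
    exact h
  -- ### normal form of `ψ`, and the conjugate `L' = g₀⁻¹ L g₀ ⊇ std(SL₂ k)`
  obtain ⟨ι, g₀, hg₀⟩ := subfieldCell_normalForm ψ hψinj hK
  set L' : Subgroup (Matrix.GeneralLinearGroup (Fin 2) K) :=
    L.comap (MulAut.conj g₀).toMonoidHom with hL'def
  have hL'mem : ∀ h, h ∈ L' ↔ g₀ * h * g₀⁻¹ ∈ L := fun h => by
    rw [hL'def, Subgroup.mem_comap]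
    rfl
  have hL'le : L' ≤ (Matrix.GeneralLinearGroup.det : Matrix.GeneralLinearGroup (Fin 2) K →* Kˣ).ker := by
    intro h hh
    have h1 := hL ((hL'mem h).1 hh)
    rw [MonoidHom.mem_ker, map_mul, map_mul, map_inv, mul_inv_cancel_comm] at h1
    exact h1
  have hS' : ∀ a : Matrix.SpecialLinearGroup (Fin 2) k,
      Matrix.SpecialLinearGroup.toGL (Matrix.SpecialLinearGroup.map ι a) ∈ L' := fun a => by
    rw [hL'mem, ← hg₀]
    exact hψL a
  rcases subfieldCell_overgroup ι hK hq5 L' hL'le hS' with hker | hsmall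
  · refine le_antisymm hL (fun g hg => ?_)
    have h1 : g₀⁻¹ * g * g₀ ∈ L' := by
      apply hker
      rw [MonoidHom.mem_ker] at hg ⊢
      rw [map_mul, map_mul, map_inv, hg, mul_one, inv_mul_cancel]
    rw [hL'mem] at h1
    simpa [mul_assoc] using h1
  · exfalso
    obtain ⟨B, hBL, hBcard⟩ := hB
    have h1 : B.card ≤ Nat.card L := by
      have h := Set.ncard_le_ncard hBL (Set.toFinite _)
      rwa [Set.ncard_coe_finset, ← Nat.card_coe_set_eq] at h
    have h2 : Nat.card L ≤ Nat.card L' := by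
      refine Nat.card_le_card_of_injective (fun h : L => (⟨g₀⁻¹ * h * g₀, ?_⟩ : L')) ?_
      · rw [hL'mem]
        simp [mul_assoc]
      · intro a b hab
        apply Subtype.ext
        have h' := congr_arg Subtype.val hab
        exact mul_left_cancel (mul_right_cancel h')
    have h3 : c₁ * (Fintype.card K : ℝ) ^ 2 ≤ (4 * q ^ 3 : ℕ) :=
      hBcard.trans (by exact_mod_cast h1.trans (h2.trans hsmall))
    rw [hK] at h3
    push_cast at h3
    have hq0 : (0 : ℝ) < q := by exact_mod_cast lt_of_lt_of_le (by norm_num) hq5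
    nlinarith [mul_pos (sub_pos.2 hqc) (pow_pos hq0 3)]

end Summit.MatrixMultiplication.MatrixMultiplication.Theorems.GradedDesignFamily.Negative
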